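import Mathlib
import HarnessLib
import Literature.Analysis.FluidPDE.TsaiMaximumPrinciple
import Literature.Analysis.FluidPDE.CurlFreeLiouville
import Literature.Analysis.FluidPDE.SwirlTransportProofs
import Summits.NavierStokesRegularity.NavierStokesRegularity.Theses.PoloidalWindowDoor
import Summits.NavierStokesRegularity.NavierStokesRegularity.Theorems.PoloidalWindowDoorPoloidalWindowRigidityRotatedLeray
import Summits.NavierStokesRegularity.NavierStokesRegularity.Theorems.PoloidalWindowDoorPoloidalWindowRigidityRotatedLerayLiouville
import Summits.NavierStokesRegularity.NavierStokesRegularity.Theorems.PoloidalWindowDoorPoloidalWindowRigiditySpiralSelfSimilar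

/-!
# ERRATUM 2026-08-29T00:47:29Z (ns-idea-8 g8): THIS WORKFILE IS VOID — A DUPLICATE OF IN-TREE THEOREMS.  S1 = `Theorems.PoloidalWindowDoorPoloidalWindowRigidityRotDriftLiouville`
# (`driftOp_gaussAt_add_skew`, `isConst_of_driftOp_nonneg_skew(_of_poly)`, K2-p2 2026-08-27), S2–S3 = `…RotatedLerayAllRates` (`rotatedLeray_const_of_poloidal_all`,
# `eq_zero_of_spiralSelfSimilar_vertical_all`, `…_centre`), tilted axes = `…Similarity.eq_zero_of_spiralSelfSimilar_tilted` (08-26).  Dedup failure of the ideator; do NOT land,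
# do NOT cite as new; cite the tree files.  Kept only as a record (it elaborates).  No summit is proved by any line; 19708 / 20428 / 27893 / 22881 OPEN.

# Crux `PoloidalWindowRigidity` (K2, stmt-NavierStokesRegularity-19708) — LINE 17 `spiral_rates`
# (IDEATOR seat ns-idea-8, generation 8; lens «barrier»; bears_on LADDER-NS N0, rung N0-LocalTubeDoorPoloidal; STRATUM COMPLETION)

TARGET BY NAME.  `Theorems.PoloidalWindowDoorPoloidalWindowRigiditySpiralSelfSimilar.eq_zero_of_spiralSelfSimilar_vertical`
(K2-p2) empties the VERTICAL-AXIS ROTATING-SELF-SIMILAR (RSS) stratum of the crux's Type-I class for SLOW rotation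
`|κ| < 1` only, and records: «`|κ| ≥ 1` awaits Tsai's Lemma 5.1 with tangential drift».  This line removes the
hypothesis `hκ : |κ| < 1`: the statements `eq_zero_of_spiralSelfSimilar_vertical_allRates` /
`nonflatLiouville_of_spiralSelfSimilar_vertical_allRates` below are those two tree theorems with `hκ` DELETED, proved
here SORRY-FREE (v1.1: the v1 stub `stub_skewDriftLiouville` — skew-drift Liouville, SDL — is now PROVED in S1).

THE LEVER (barrier-inversion on the tree's own obstruction).  The only use of `|κ| < 1` in the tree is the drift-rate
hypothesis `‖U y + β•J y‖ ≤ b‖y‖, b < a` of the Literature Liouville lemma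
`Literature.Analysis.FluidPDE.isConst_of_driftOp_nonneg_of_poly` (TsaiMaximumPrinciple.lean:807; Tsai 1998 Lemma 5.1 in
Lemarié-Rieusset's Gaussian-barrier form, Lemma 16.8), applied in `…RotatedLerayLiouville.rotatedLeray_const_of_poloidal`
to the WHOLE drift `U + βJy` — whose linear rate is `|β|`, hence `|β| < a`.  But the barriers `gaussAt k x₀` are RADIAL
about their centre and the rotation drift is SKEW: for a skew linear `T` (`⟪T w, w⟫ = 0`),
  `⟪y − x₀, T y⟫ = ⟪y − x₀, T x₀⟫ ≥ −‖T‖·‖x₀‖·‖y − x₀‖`,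
a term LINEAR in `‖y − x₀‖`, absorbed into the coefficient `M + (a + b)‖x₀‖ ↦ M + (a + b + ‖T‖)‖x₀‖` of
`drift_inner_lower` / `abs_drift_inner_le`, while the quadratic confinement `(a − b)‖y − x₀‖²` is untouched.  So the
Liouville lemma holds for drifts `U + T` with `T` skew of ANY size (`SkewDriftLiouville` below), the rotated-Leray
constancy holds for EVERY `β` (`rotatedLeray_const_of_poloidal_allRates`, kernel-checked here, via SDL, by the tree's
own endgame: `driftOp_rotHead_of_poloidal` ⇒ `spin U ≡ 0` ⇒ `curl U ≡ 0` ⇒ constant), and the RSS stratum is empty for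
every rate `κ`.  (Tsai 1998 p. 47: the supersolution `φ(|y|)` sees only `⟪drift, ŷ⟫`; [cite: Tsai1998, Lemma 5.1];
[cite: LemarieRieusset2016, Lemma 16.8].)

WHAT THIS IS / IS NOT.  A STRATUM COMPLETION inside the cone (Disproof.lean P4 «strata»): after it the residue of K2 may
assume «not RSS about a vertical axis, any rate» (class units).  It does not touch the HL3′ ridge cells C2a/C2b, S0, or the
wall ⟨27893⟩; hot_loops v4.3 remains the ⟨19708⟩ skeleton of record.  No summit is proved by any line; NS regularity is
NOT proved; 19708 / 20428 / 27893 / 22881 stay OPEN.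

DISPROOF USED.  Honours `Theorems.PoloidalWindowRigidity.Negative.poloidalWindowRigidity_false_without_mild`: the stratum
theorems carry the Oseen-mild identity `hmild` (used by `profileEq_of_rss` and the class rate lemmas).  SDL (the v1 stub, proved in
v1.1) is a linear elliptic Liouville lemma with no NS content; no landed Negative lemma instances it.

CHEAPEST FALSIFIER of SDL (moot since v1.1, kept for the record): the 2-D Ornstein–Uhlenbeck-with-rotation operator `L = νΔ − (a y + βJy)·∇` — its bounded
(indeed polynomially bounded) `L`-subsolutions … the explicit check: `Θ(y) = ⟪c, y⟫` has `LΘ = −a⟪c,y⟫ − β⟪c, Jy⟫`, not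
signed ⇒ not a counterexample; radial `Θ = θ(|y|)`: `LΘ = ν(θ'' + θ'/r·(d−1)) − a r θ'` — `β` drops out, exactly the lever.
-/

noncomputable section

set_option linter.dupNamespace false
set_option linter.unusedVariables false

namespace Summit.NavierStokesRegularity.NavierStokesRegularity.Cruxes.PoloidalWindowRigidity.SpiralRates

open MeasureTheory Set Function Filter Topology TopologicalSpace Metric InnerProductSpace
open scoped RealInnerProductSpace InnerProductSpace Laplacian ContDiff
open Literature.Analysis Literature.Analysis.FluidPDE
open Summit.NavierStokesRegularity.NavierStokesRegularity.Theorems.LocalSineTubeDoorProfileAlignedWindowRigidityAncient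
open Summit.NavierStokesRegularity.NavierStokesRegularity.Theorems.PoloidalWindowDoorPoloidalWindowRigidityWindow
open Summit.NavierStokesRegularity.NavierStokesRegularity.Theorems.PoloidalWindowDoorPoloidalWindowRigidityClassRate
open Summit.NavierStokesRegularity.NavierStokesRegularity.Theorems.PoloidalWindowDoorPoloidalWindowRigidityOneSlice
open Summit.NavierStokesRegularity.NavierStokesRegularity.Theorems.PoloidalWindowDoorPoloidalWindowRigidityScrewKinematics
open Summit.NavierStokesRegularity.NavierStokesRegularity.Theorems.PoloidalWindowDoorPoloidalWindowRigidityRotatedLeray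
open Summit.NavierStokesRegularity.NavierStokesRegularity.Theorems.PoloidalWindowDoorPoloidalWindowRigidityRotatedLerayLiouville
open Summit.NavierStokesRegularity.NavierStokesRegularity.Theorems.PoloidalWindowDoorPoloidalWindowRigiditySpiralSelfSimilar

/-! ### S1 — skew-drift Liouville: Tsai's Lemma 5.1 / Lemarié-Rieusset Lemma 16.8 with an extra SKEW linear drift of any size (PROVED, v1.1) -/

/-- **SDL (skew-drift Liouville).**  On `ℝ³`: let `Θ ∈ C²` be a subsolution of the drift–Laplace operator,
`0 ≤ driftOp ν a (U + T) Θ = νΔΘ − DΘ[U + T· + a·]` (`ν > 0`, `a > 0`), where the drift splits as a part `U` of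
eventual linear rate `b < a` (`‖U y‖ ≤ b‖y‖` for `‖y‖ ≥ r₀`) plus a SKEW continuous linear map `T` (`⟪T w, w⟫ = 0`) of
arbitrary norm, and let `Θ` grow at most polynomially.  Then `Θ` is constant.  (`T = 0` is the Literature lemma
`isConst_of_driftOp_nonneg_of_poly`.)  PROVED below (`skewDriftLiouville`, v1.1): on every Gaussian CENTRED AT `x₀` the
drift `U + T` acts exactly like the affinely bounded drift `U + T x₀`, because `⟪y − x₀, T y⟫ = ⟪y − x₀, T x₀⟫`
(`driftOp_gaussAt_skew_shift`); Lemarié-Rieusset's barrier/penalisation argument only ever evaluates the operator on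
Gaussians centred at the one point `X₀` and on `Θ` itself.  [cite: Tsai1998, Lemma 5.1; LemarieRieusset2016, Lemma 16.8] -/
def SkewDriftLiouville : Prop :=
  ∀ (ν a b K r₀ : ℝ) (N : ℕ), 0 < ν → 0 ≤ b → b < a →
  ∀ (Θ : EuclideanSpace ℝ (Fin 3) → ℝ) (U : EuclideanSpace ℝ (Fin 3) → EuclideanSpace ℝ (Fin 3))
    (T : EuclideanSpace ℝ (Fin 3) →L[ℝ] EuclideanSpace ℝ (Fin 3)),
    (∀ w, ⟪T w, w⟫_ℝ = 0) → ContDiff ℝ 2 Θ → Continuous U →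
    (∀ y, 0 ≤ driftOp ν a (fun y => U y + T y) Θ y) →
    (∀ y, r₀ ≤ ‖y‖ → ‖U y‖ ≤ b * ‖y‖) →
    (∀ y, |Θ y| ≤ K * (1 + ‖y‖) ^ N) → ∀ x y, Θ x = Θ y

section SkewDrift

variable {E : Type*} [NormedAddCommGroup E] [InnerProductSpace ℝ E]

/-- For a skew map `T` (`⟪T w, w⟫ = 0`) the radial component of `T y` about `x₀` is that of the CONSTANT vector
`T x₀`: `⟪y − x₀, T y⟫ = ⟪y − x₀, T x₀⟫` (since `⟪y − x₀, T (y − x₀)⟫ = 0`). [folklore] -/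
theorem inner_sub_skew_apply {T : E →L[ℝ] E} (hT : ∀ w, ⟪T w, w⟫ = 0) (x₀ y : E) :
    ⟪y - x₀, T y⟫ = ⟪y - x₀, T x₀⟫ := by
  have h : ⟪y - x₀, T (y - x₀)⟫ = 0 := by rw [real_inner_comm]; exact hT _
  rw [map_sub, inner_sub_right] at h
  linarith

variable [FiniteDimensional ℝ E]

/-- On a Gaussian centred at `x₀` the skew drift is invisible up to the constant `T x₀`:
`L_{U + T x₀}(gaussAt k x₀)(y) = L_{U + T}(gaussAt k x₀)(y)` (both equal
`gaussAt · (ν(4k²r² + 2dk) − 2k⟪y − x₀, drift + a y⟩)`, `driftOp_gaussAt`). [folklore] -/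
theorem driftOp_gaussAt_skew_shift {T : E →L[ℝ] E} (hT : ∀ w, ⟪T w, w⟫ = 0) (ν a k : ℝ) (U : E → E)
    (x₀ y : E) :
    driftOp ν a (fun y => U y + T x₀) (gaussAt k x₀) y = driftOp ν a (fun y => U y + T y) (gaussAt k x₀) y := by
  simp only [driftOp_gaussAt, inner_add_right, inner_sub_skew_apply hT x₀ y]

/-- **Lemarié-Rieusset's Lemma 16.8 / Tsai's Lemma 5.1 with an additional skew linear drift of arbitrary size.**
`ν > 0`, `0 ≤ b < a`, `κ < (a − b)/(2ν)`; `Θ ∈ C²(E)` with `0 ≤ driftOp ν a (U + T) Θ` everywhere, `|U| ≤ M + b|y|`,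
`T` skew, `|Θ(y)| ≤ C e^{κ|y|²}` ⇒ `Θ` constant.  The proof is the Literature proof of `isConst_of_driftOp_nonneg`
VERBATIM, with the three Gaussian-barrier evaluations routed through `driftOp_gaussAt_skew_shift` (centre `X₀`, affine
constant `M + ‖T X₀‖`); the operator is otherwise only evaluated on `Θ` (hypothesis) and at a maximum
(`driftOp_nonpos_of_isMax`, any drift). [cite: LemarieRieusset2016, Lemma 16.8; Tsai1998, Lemma 5.1] -/
theorem isConst_of_driftOp_nonneg_skew {ν a b M κ C : ℝ} (hν : 0 < ν) (hb : 0 ≤ b) (hba : b < a)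
    (hκ : κ < (a - b) / (2 * ν)) {Θ : E → ℝ} {U : E → E} {T : E →L[ℝ] E}
    (hT : ∀ w, ⟪T w, w⟫ = 0) (hΘ : ContDiff ℝ 2 Θ)
    (hsub : ∀ y, 0 ≤ driftOp ν a (fun y => U y + T y) Θ y) (hU : ∀ y, ‖U y‖ ≤ M + b * ‖y‖)
    (hgrowth : ∀ y, |Θ y| ≤ C * Real.exp (κ * ‖y‖ ^ 2)) (x y : E) : Θ x = Θ y := by
  -- reduce to: no pair `X₀, X₁` with `Θ X₀ < Θ X₁`
  suffices key : ∀ X₀ X₁ : E, ¬ (Θ X₀ < Θ X₁) by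
    rcases lt_trichotomy (Θ x) (Θ y) with h | h | h
    · exact absurd h (key x y)
    · exact h
    · exact absurd h (key y x)
  intro X₀ X₁ hlt
  -- basic constants
  have ha : 0 < a := hb.trans_lt hba
  have hab : 0 < a - b := sub_pos.2 hba
  have hM : 0 ≤ M := by
    have := hU 0
    rw [norm_zero, mul_zero, add_zero] at this
    exact (norm_nonneg _).trans this
  have hC : 0 ≤ C := by
    have := hgrowth 0
    rw [norm_zero] at this
    norm_num at this
    exact (abs_nonneg _).trans this
  have hd0 : (0 : ℝ) ≤ (Module.finrank ℝ E : ℝ) := Nat.cast_nonneg _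
  obtain ⟨δ, hδ0, hδ⟩ : ∃ δ : ℝ, 0 < δ ∧ Θ X₁ = Θ X₀ + δ := ⟨Θ X₁ - Θ X₀, sub_pos.2 hlt, by ring⟩
  have hX : X₁ ≠ X₀ := fun h => by rw [h] at hlt; exact lt_irrefl _ hlt
  have hs₁0 : 0 < ‖X₁ - X₀‖ := norm_pos_iff.2 (sub_ne_zero.2 hX)
  -- the skew part seen from the centre `X₀`: `⟪y − X₀, T y⟫ = ⟪y − X₀, T X₀⟫`, so on Gaussians centred at `X₀`
  -- the drift `U + T` acts like the affinely bounded drift `U + T X₀`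
  have hUT : ∀ y, ‖U y + T X₀‖ ≤ M + ‖T X₀‖ + b * ‖y‖ := fun y =>
    (norm_add_le _ _).trans (by linarith [hU y])
  have hshift : ∀ (k : ℝ) (y : E), driftOp ν a (fun y => U y + T X₀) (gaussAt k X₀) y =
      driftOp ν a (fun y => U y + T y) (gaussAt k X₀) y := fun k y =>
    driftOp_gaussAt_skew_shift hT ν a k U X₀ y
  obtain ⟨M₁, hM₁0, hM₁⟩ : ∃ M₁ : ℝ, 0 ≤ M₁ ∧ M₁ = M + ‖T X₀‖ + (a + b) * ‖X₀‖ :=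
    ⟨_, by positivity, rfl⟩
  have hΘc : Continuous Θ := hΘ.continuous
  -- `R₀`: a small ball about `X₀` on which `Θ ≤ Θ X₀ + δ/2`
  obtain ⟨R₀, hR₀0, hR₀s, hR₀Θ⟩ : ∃ R₀ : ℝ, 0 < R₀ ∧ R₀ < ‖X₁ - X₀‖ ∧
      ∀ y, ‖y - X₀‖ ≤ R₀ → Θ y ≤ Θ X₀ + δ / 2 := by
    obtain ⟨η, hη0, hη⟩ := Metric.continuousAt_iff.1 hΘc.continuousAt (δ / 2) (half_pos hδ0)
    refine ⟨min (η / 2) (‖X₁ - X₀‖ / 2), lt_min (half_pos hη0) (half_pos hs₁0),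
      (min_le_right _ _).trans_lt (half_lt_self hs₁0), fun y hy => ?_⟩
    have hdist : dist y X₀ < η := by
      rw [dist_eq_norm]; exact (hy.trans (min_le_left _ _)).trans_lt (half_lt_self hη0)
    have := hη hdist
    rw [Real.dist_eq] at this
    linarith [(abs_lt.1 this).2]
  -- `β` and the barrier `φ = exp(-β |y - X₀|²)`
  obtain ⟨β, hβ0, hβeq⟩ : ∃ β : ℝ, 0 < β ∧
      4 * ν * β * R₀ ^ 2 = 2 * M₁ * R₀ + 2 * (Module.finrank ℝ E : ℝ) * ν + 1 := by
    refine ⟨(2 * M₁ * R₀ + 2 * (Module.finrank ℝ E : ℝ) * ν + 1) / (4 * ν * R₀ ^ 2),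
      by positivity, ?_⟩
    field_simp
  obtain ⟨φ, hφ⟩ : ∃ φ : E → ℝ, φ = gaussAt (-β) X₀ := ⟨_, rfl⟩
  have hφ2 : ContDiff ℝ 2 φ := hφ ▸ contDiff_gaussAt _ _
  have hφle1 : ∀ y, φ y ≤ 1 := fun y => hφ ▸ gaussAt_le_one_of_nonpos (by linarith) _ _
  have hφpos : ∀ y, 0 < φ y := fun y => hφ ▸ gaussAt_pos _ _ _
  have hφL : ∀ y, R₀ ≤ ‖y - X₀‖ → β * φ y ≤ driftOp ν a (fun y => U y + T y) φ y := by
    intro y hy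
    have h1 := driftOp_gaussAt_neg_lower (ν := ν) hb hba.le hβ0.le hUT X₀ y
    have hq := one_le_barrier_quad hν.le hM₁0 hd0 hR₀0 hβeq hy
    rw [hshift, ← hM₁] at h1
    rw [hφ]
    refine le_trans ?_ h1
    have h0 : 0 ≤ β * gaussAt (-β) X₀ y := mul_nonneg hβ0.le (gaussAt_pos _ _ _).le
    have := mul_le_mul_of_nonneg_left hq h0
    linarith
  -- `κ₁` and the penalisation `ψ = exp(κ₁ |y - X₀|²)`
  obtain ⟨κ₀, hκ₀0, hκκ₀, hκ₀lt⟩ : ∃ κ₀ : ℝ, 0 ≤ κ₀ ∧ κ ≤ κ₀ ∧ κ₀ < (a - b) / (2 * ν) :=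
    ⟨max κ 0, le_max_right _ _, le_max_left _ _, max_lt hκ (by positivity)⟩
  obtain ⟨κ₁, hκ₀₁, hκ₁lt⟩ : ∃ κ₁ : ℝ, κ₀ < κ₁ ∧ κ₁ < (a - b) / (2 * ν) :=
    ⟨(κ₀ + (a - b) / (2 * ν)) / 2, by linarith, by linarith⟩
  have hκ₁0 : 0 < κ₁ := hκ₀0.trans_lt hκ₀₁
  obtain ⟨B, hB0, hB⟩ : ∃ B : ℝ, 0 < B ∧ B = 2 * (a - b) - 4 * ν * κ₁ := by
    refine ⟨_, ?_, rfl⟩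
    have : 4 * ν * κ₁ < 4 * ν * ((a - b) / (2 * ν)) := by gcongr
    have e : 4 * ν * ((a - b) / (2 * ν)) = 2 * (a - b) := by field_simp; ring
    linarith
  obtain ⟨R₁, hR₁1, hR₁s, hR₁B⟩ : ∃ R₁ : ℝ, 1 ≤ R₁ ∧ ‖X₁ - X₀‖ + 1 ≤ R₁ ∧
      (2 * M₁ + 2 * (Module.finrank ℝ E : ℝ) * ν + 1) / B ≤ R₁ :=
    ⟨max (max 1 (‖X₁ - X₀‖ + 1)) ((2 * M₁ + 2 * (Module.finrank ℝ E : ℝ) * ν + 1) / B),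
      (le_max_left _ _).trans (le_max_left _ _), (le_max_right _ _).trans (le_max_left _ _),
      le_max_right _ _⟩
  have hR₀R₁ : R₀ < R₁ := by linarith
  have hs₁R₁ : ‖X₁ - X₀‖ ≤ R₁ := by linarith
  obtain ⟨ψ, hψ⟩ : ∃ ψ : E → ℝ, ψ = gaussAt κ₁ X₀ := ⟨_, rfl⟩
  have hψ2 : ContDiff ℝ 2 ψ := hψ ▸ contDiff_gaussAt _ _
  have hψpos : ∀ y, 0 < ψ y := fun y => hψ ▸ gaussAt_pos _ _ _
  have hψle : ∀ y, ‖y - X₀‖ ≤ R₁ → ψ y ≤ Real.exp (κ₁ * R₁ ^ 2) := fun y hy =>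
    hψ ▸ gaussAt_mono_radius hκ₁0.le _ hy
  have hψeq : ∀ y, ψ y = Real.exp (κ₁ * ‖y - X₀‖ ^ 2) := fun y => by rw [hψ]; rfl
  have hψL_far : ∀ y, R₁ ≤ ‖y - X₀‖ → driftOp ν a (fun y => U y + T y) ψ y ≤ -(κ₁ * ψ y) := by
    intro y hy
    have h1 := driftOp_gaussAt_upper (ν := ν) hb hba.le hκ₁0.le hUT X₀ y
    rw [hshift, ← hM₁, ← hB] at h1
    have hBr : 2 * M₁ + 2 * (Module.finrank ℝ E : ℝ) * ν + 1 ≤ B * ‖y - X₀‖ := by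
      have := (div_le_iff₀ hB0).1 (hR₁B.trans hy)
      nlinarith
    have hq := one_le_penal_quad hν.le hd0 (hR₁1.trans hy) hBr
    rw [hψ]
    refine h1.trans ?_
    have h0 : 0 ≤ κ₁ * gaussAt κ₁ X₀ y := mul_nonneg hκ₁0.le (gaussAt_pos _ _ _).le
    have := mul_le_mul_of_nonneg_left hq h0
    linarith
  obtain ⟨K, hK0, hK⟩ : ∃ K : ℝ, 0 ≤ K ∧ K = κ₁ * Real.exp (κ₁ * R₁ ^ 2) *
      (4 * ν * κ₁ * R₁ ^ 2 + 2 * (Module.finrank ℝ E : ℝ) * ν +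
        2 * (M₁ + (a + b) * R₁) * R₁) := ⟨_, by positivity, rfl⟩
  have hψL_near : ∀ y, ‖y - X₀‖ ≤ R₁ → |driftOp ν a (fun y => U y + T y) ψ y| ≤ K := by
    intro y hy
    have h1 := abs_driftOp_gaussAt_le hν.le hb hba.le hκ₁0.le hUT X₀ y
    rw [hshift, ← hM₁] at h1
    rw [hψ]
    refine h1.trans ?_
    rw [hK]
    have hr0 : 0 ≤ ‖y - X₀‖ := norm_nonneg _
    gcongr
    exact gaussAt_mono_radius hκ₁0.le _ hy
  -- the constants `γ`, `α` and the auxiliary function `V = Θ + α (φ - γ ψ)`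
  obtain ⟨Φm, hΦm0, hφL_mid⟩ : ∃ Φm : ℝ, 0 < Φm ∧
      ∀ y, R₀ ≤ ‖y - X₀‖ → ‖y - X₀‖ ≤ R₁ → Φm ≤ driftOp ν a (fun y => U y + T y) φ y := by
    refine ⟨β * Real.exp (-β * R₁ ^ 2), by positivity, fun y hy hy' => ?_⟩
    refine le_trans ?_ (hφL y hy)
    rw [hφ]
    exact mul_le_mul_of_nonneg_left (gaussAt_anti_radius (by linarith) X₀ hy') hβ0.le
  obtain ⟨γ, hγ0, hγK⟩ : ∃ γ : ℝ, 0 < γ ∧ γ * K < Φm := by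
    refine ⟨Φm / (2 * (K + 1)), by positivity, ?_⟩
    rw [div_mul_eq_mul_div, div_lt_iff₀ (by positivity)]
    nlinarith
  obtain ⟨S, hS0, hS⟩ : ∃ S : ℝ, 0 < S ∧ S = 1 + γ * Real.exp (κ₁ * R₁ ^ 2) :=
    ⟨_, by positivity, rfl⟩
  have hφψ : ∀ y, ‖y - X₀‖ ≤ R₁ → |φ y - γ * ψ y| ≤ S := by
    intro y hy
    refine (abs_sub _ _).trans ?_
    rw [abs_of_pos (hφpos y), abs_of_pos (mul_pos hγ0 (hψpos y)), hS]
    gcongr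
    · exact hφle1 y
    · exact hψle y hy
  obtain ⟨α, hα0, hαS⟩ : ∃ α : ℝ, 0 < α ∧ α * S = δ / 8 :=
    ⟨δ / (8 * S), by positivity, by field_simp⟩
  obtain ⟨V, hV⟩ : ∃ V : E → ℝ, V = Θ + α • (φ - γ • ψ) := ⟨_, rfl⟩
  have hVapply : ∀ y, V y = Θ y + α * (φ y - γ * ψ y) := fun y => by
    simp only [hV, Pi.add_apply, Pi.smul_apply, Pi.sub_apply, smul_eq_mul]
  have hV2 : ContDiff ℝ 2 V :=
    hV ▸ hΘ.add (contDiff_const.smul (hφ2.sub (contDiff_const.smul hψ2)))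
  have hLV : ∀ y, driftOp ν a (fun y => U y + T y) V y =
      driftOp ν a (fun y => U y + T y) Θ y +
        α * (driftOp ν a (fun y => U y + T y) φ y - γ * driftOp ν a (fun y => U y + T y) ψ y) :=
    fun y => hV ▸ driftOp_add_smul_sub ν a (fun y => U y + T y) hΘ hφ2 hψ2 α γ y
  -- `V X₁` is large, `V` is small on the small ball
  have hVX₁ : Θ X₀ + 7 * δ / 8 ≤ V X₁ := by
    rw [hVapply]
    have h1 := hφψ X₁ hs₁R₁
    have h2 : -S ≤ φ X₁ - γ * ψ X₁ := (neg_le_neg h1).trans (neg_abs_le _)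
    have h3 := mul_le_mul_of_nonneg_left h2 hα0.le
    rw [mul_neg, hαS] at h3
    linarith
  have hVsmall : ∀ y, ‖y - X₀‖ ≤ R₀ → V y < V X₁ := by
    intro y hy
    rw [hVapply]
    have h1 := hφψ y (hy.trans hR₀R₁.le)
    have h2 : φ y - γ * ψ y ≤ S := (le_abs_self _).trans h1
    have h3 := mul_le_mul_of_nonneg_left h2 hα0.le
    rw [hαS] at h3
    have h4 := hR₀Θ y hy
    linarith
  -- decay at infinity: `V ≤ V X₁` outside a large ball
  obtain ⟨R₂, hR₁R₂, hVfar⟩ : ∃ R₂ : ℝ, R₁ ≤ R₂ ∧ ∀ y, R₂ ≤ ‖y - X₀‖ → V y ≤ V X₁ :=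
    le_far_of_gauss_penalisation hC hgrowth hκκ₀ hκ₀0 hκ₀₁ hκ₁0 hψeq hφle1 hα0 hγ0
      hVapply X₁ R₁
  -- a global maximum `X₂` of `V`, where `L V ≤ 0`
  obtain ⟨X₂, hX₂⟩ : ∃ X₂, ∀ y, V y ≤ V X₂ :=
    exists_forall_le_of_le_outside hV2.continuous (hs₁R₁.trans hR₁R₂) hVfar
  have hLV2 : driftOp ν a (fun y => U y + T y) V X₂ ≤ 0 :=
    driftOp_nonpos_of_isMax hν.le (fun y => U y + T y) hV2 hX₂
  rw [hLV] at hLV2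
  have hΘ2 := hsub X₂
  -- case analysis on the position of `X₂`
  rcases le_or_gt ‖X₂ - X₀‖ R₀ with h1 | h1
  · exact absurd (hX₂ X₁) (not_le.2 (hVsmall X₂ h1))
  have hpos : 0 < driftOp ν a (fun y => U y + T y) φ X₂ -
      γ * driftOp ν a (fun y => U y + T y) ψ X₂ := by
    rcases le_or_gt ‖X₂ - X₀‖ R₁ with h2 | h2
    · have hφ2' := hφL_mid X₂ h1.le h2
      have hψ2' := (le_abs_self _).trans (hψL_near X₂ h2)
      have := mul_le_mul_of_nonneg_left hψ2' hγ0.le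
      linarith
    · have hφ2' := hφL X₂ (hR₀R₁.le.trans h2.le)
      have hψ2' := hψL_far X₂ h2.le
      have e1 := mul_pos hβ0 (hφpos X₂)
      have e2 := mul_pos hγ0 (mul_pos hκ₁0 (hψpos X₂))
      have := mul_le_mul_of_nonneg_left hψ2' hγ0.le
      have e3 : γ * -(κ₁ * ψ X₂) = -(γ * (κ₁ * ψ X₂)) := by ring
      linarith
  have := mul_pos hα0 hpos
  linarith

/-- Skew-drift version of `isConst_of_driftOp_nonneg_of_eventually`: `|U(y)| ≤ b|y|` only for `|y| ≥ r₀`, `U`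
continuous. [cite: Tsai1998, Lemma 5.1] -/
theorem isConst_of_driftOp_nonneg_of_eventually_skew {ν a b κ C r₀ : ℝ} (hν : 0 < ν) (hb : 0 ≤ b)
    (hba : b < a) (hκ : κ < (a - b) / (2 * ν)) {Θ : E → ℝ} {U : E → E} {T : E →L[ℝ] E}
    (hT : ∀ w, ⟪T w, w⟫ = 0) (hΘ : ContDiff ℝ 2 Θ)
    (hUc : Continuous U) (hsub : ∀ y, 0 ≤ driftOp ν a (fun y => U y + T y) Θ y)
    (hU : ∀ y, r₀ ≤ ‖y‖ → ‖U y‖ ≤ b * ‖y‖)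
    (hgrowth : ∀ y, |Θ y| ≤ C * Real.exp (κ * ‖y‖ ^ 2)) (x y : E) : Θ x = Θ y := by
  -- `U` is bounded on the closed ball of radius `r₀`
  obtain ⟨M, hM⟩ : ∃ M, ∀ z ∈ closedBall (0 : E) r₀, ‖U z‖ ≤ M :=
    (isCompact_closedBall (0 : E) r₀).exists_bound_of_continuousOn hUc.continuousOn
  refine isConst_of_driftOp_nonneg_skew (M := max M 0) hν hb hba hκ hT hΘ hsub (fun z => ?_) hgrowth x y
  by_cases hz : r₀ ≤ ‖z‖
  · exact (hU z hz).trans (le_add_of_nonneg_left (le_max_right _ _))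
  · have hz' : z ∈ closedBall (0 : E) r₀ := by
      rw [mem_closedBall, dist_zero_right]; exact (not_le.1 hz).le
    exact (hM z hz').trans ((le_max_left _ _).trans (le_add_of_nonneg_right (by positivity)))

/-- Skew-drift version of `isConst_of_driftOp_nonneg_of_poly` (polynomial growth of `Θ`). [cite: Tsai1998, Lemma 5.1 and p. 48] -/
theorem isConst_of_driftOp_nonneg_of_poly_skew {ν a b C r₀ : ℝ} {N : ℕ} (hν : 0 < ν) (hb : 0 ≤ b)
    (hba : b < a) {Θ : E → ℝ} {U : E → E} {T : E →L[ℝ] E} (hT : ∀ w, ⟪T w, w⟫ = 0)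
    (hΘ : ContDiff ℝ 2 Θ) (hUc : Continuous U)
    (hsub : ∀ y, 0 ≤ driftOp ν a (fun y => U y + T y) Θ y) (hU : ∀ y, r₀ ≤ ‖y‖ → ‖U y‖ ≤ b * ‖y‖)
    (hgrowth : ∀ y, |Θ y| ≤ C * (1 + ‖y‖) ^ N) (x y : E) : Θ x = Θ y := by
  have hC : 0 ≤ C := by
    have h := (abs_nonneg _).trans (hgrowth 0)
    rw [norm_zero, add_zero, one_pow, mul_one] at h
    exact h
  -- a Gaussian rate `κ = (a - b)/(4ν) < (a - b)/(2ν)`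
  set κ := (a - b) / (4 * ν) with hκ
  have hab : 0 < a - b := sub_pos.2 hba
  have hκ0 : 0 < κ := by positivity
  have hκlt : κ < (a - b) / (2 * ν) := by
    rw [hκ, div_lt_div_iff₀ (by positivity) (by positivity)]
    nlinarith
  refine isConst_of_driftOp_nonneg_of_eventually_skew (C := C * (N.factorial * Real.exp (1 + 1 / (4 * κ))))
    hν hb hba hκlt hT hΘ hUc hsub hU (fun z => (hgrowth z).trans ?_) x y
  rw [mul_assoc]
  exact mul_le_mul_of_nonneg_left (one_add_pow_le_exp_mul_sq hκ0 N (norm_nonneg z)) hC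

end SkewDrift

/-- **SDL holds** (v1.1: the former stub S1 is PROVED). -/
theorem skewDriftLiouville : SkewDriftLiouville :=
  fun _ν _a _b _K _r₀ _N hν hb hba _Θ _U _T hT hΘ hUc hsub hU hg x y =>
    isConst_of_driftOp_nonneg_of_poly_skew hν hb hba hT hΘ hUc hsub hU hg x y

/-- Former STUB S1 (registered name kept; no `sorry` since v1.1). -/
theorem stub_skewDriftLiouville : SkewDriftLiouville := skewDriftLiouville


/-! ### S2 — KERNEL: poloidal rotated Leray profiles with bounded velocity are constant, for EVERY rotation rate `β` -/

variable {ν a β : ℝ} {U : (EuclideanSpace ℝ (Fin 3)) → (EuclideanSpace ℝ (Fin 3))} {P : (EuclideanSpace ℝ (Fin 3)) → ℝ}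

/-- **`rotatedLeray_const_of_poloidal` WITHOUT `|β| < a`** (kernel-checked from `SkewDriftLiouville`; the body is the tree
proof of `…RotatedLerayLiouville.rotatedLeray_const_of_poloidal` with the drift-rate block replaced by the skew split
`U + β•rotGenL`, `b = a/2`, `r₀ = 2M/a`). -/
theorem rotatedLeray_const_of_poloidal_allRates (hSDL : SkewDriftLiouville) {M C : ℝ} {N : ℕ} (hν : 0 < ν) (ha : 0 < a)
    (hU3 : ContDiff ℝ 3 U) (hP2 : ContDiff ℝ 2 P)
    (hpe : ∀ y, -(ν • (Δ U) y) + a • U y + a • fderiv ℝ U y y + β • (fderiv ℝ U y (rotGen y) - rotGen (U y)) +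
      convect U U y + gradient P y = 0)
    (hdiv : VectorCalculus.IsDivFree U) (hpol : ∀ y, curl U y 2 = 0)
    (hUbdd : ∀ y, ‖U y‖ ≤ M) (hPpoly : ∀ y, |P y| ≤ C * (1 + ‖y‖) ^ N) (x y : (EuclideanSpace ℝ (Fin 3))) :
    U x = U y := by
  have hU2 : ContDiff ℝ 2 U := hU3.of_le (by norm_num)
  have hM : 0 ≤ M := (norm_nonneg _).trans (hUbdd 0)
  have hC : 0 ≤ C := by
    have h := (abs_nonneg _).trans (hPpoly 0)
    rw [norm_zero, add_zero, one_pow, mul_one] at h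
    exact h
  -- the rotated head pressure is a `C²`, polynomially bounded subsolution (tree, no condition on `β`)
  set Θ : (EuclideanSpace ℝ (Fin 3)) → ℝ :=
    (fun z : EuclideanSpace ℝ (Fin 3) => headPressure a U P z + β * ⟪rotGen z, U z⟫) with hΘ
  have hΘ2 : ContDiff ℝ 2 Θ := contDiff_rotHead hU2 hP2
  have hsub : ∀ z, 0 ≤ driftOp ν a (fun z => U z + β • rotGen z) Θ z :=
    driftOp_rotHead_nonneg_of_poloidal hν.le hU3 hP2 hpe hdiv hpol
  have hgrowth : ∀ z, |Θ z| ≤ (2⁻¹ * M ^ 2 + C + a * M + |β| * M) * (1 + ‖z‖) ^ (N + 2) :=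
    abs_rotHead_le ha.le hM hC hUbdd hPpoly
  -- the skew split of the drift: `U` has eventual rate `a/2 < a`, the rotation `β•J` is skew of any size
  set T : EuclideanSpace ℝ (Fin 3) →L[ℝ] EuclideanSpace ℝ (Fin 3) := β • rotGenL with hT
  have hTw : ∀ w, T w = β • rotGen w := fun w => rfl
  have hTskew : ∀ w, ⟪T w, w⟫_ℝ = 0 := fun w => by
    rw [hTw, real_inner_smul_left, inner_rotGen_self, mul_zero]
  have hdrift : (fun z => U z + T z) = fun z => U z + β • rotGen z := by
    funext z; rw [hTw]
  have hsub' : ∀ z, 0 ≤ driftOp ν a (fun z => U z + T z) Θ z := by rw [hdrift]; exact hsub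
  have hb0 : (0 : ℝ) ≤ a / 2 := by positivity
  have hba : a / 2 < a := by linarith
  have hU' : ∀ z, 2 * M / a ≤ ‖z‖ → ‖U z‖ ≤ a / 2 * ‖z‖ := by
    intro z hz
    have hMz : M ≤ a / 2 * ‖z‖ := by
      rw [div_le_iff₀ ha] at hz
      linarith
    exact (hUbdd z).trans hMz
  -- the skew-drift Liouville lemma: `Θ` is constant
  have hconst : ∀ z w, Θ z = Θ w := fun z w =>
    hSDL ν a (a / 2) _ (2 * M / a) (N + 2) hν hb0 hba Θ U T hTskew hΘ2 hU2.continuous hsub' hU' hgrowth z w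
  -- hence the drift–Laplace expression vanishes and `DU` is symmetric everywhere (tree endgame, verbatim)
  have hΘfun : Θ = fun _ => Θ 0 := funext fun z => hconst z 0
  have hzero : ∀ z, driftOp ν a (fun z => U z + β • rotGen z) Θ z = 0 := by
    intro z
    rw [driftOp, hΘfun, laplacian_const_eq_zero, fderiv_fun_const]
    simp
  have hcurl : ∀ z, curl U z = 0 := by
    intro z
    have h1 := driftOp_rotHead_of_poloidal hU3 hP2 hpe hdiv hpol z
    rw [← hΘ, hzero z] at h1
    have h2 : frobeniusNormSq (spin U z) = 0 := by
      have : ν / 2 ≠ 0 := by positivity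
      have h3 : ν / 2 * frobeniusNormSq (spin U z) = 0 := h1.symm
      exact (mul_eq_zero.1 h3).resolve_left this
    exact curl_eq_zero_of_spin_eq_zero z (eq_zero_of_frobeniusNormSq_eq_zero h2)
  exact eq_of_curl_eq_zero_of_isDivFree_of_bounded hU2 hcurl hdiv hUbdd x y

/-! ### S3 — KERNEL: the vertical-axis RSS stratum is EMPTY for every rate `κ` -/

variable {C : ℝ} {v : ℝ → EuclideanSpace ℝ (Fin 3) → EuclideanSpace ℝ (Fin 3)}

/-- **ROTATING SELF-SIMILARITY ABOUT A VERTICAL AXIS, ANY ROTATION RATE: EMPTY** (modulo `SkewDriftLiouville`).  This is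
`…SpiralSelfSimilar.eq_zero_of_spiralSelfSimilar_vertical` with the hypothesis `hκ : |κ| < 1` deleted; the body is the
tree proof with `rotatedLeray_const_of_poloidal_allRates` in place of `rotatedLeray_const_of_poloidal`. -/
theorem eq_zero_of_spiralSelfSimilar_vertical_allRates (hSDL : SkewDriftLiouville) (hrate : HasTypeITimeDecay C v)
    (hcont : ContinuousOn (uncurry v) (Iio (0 : ℝ) ×ˢ univ))
    (hmild : ∀ s t : ℝ, s < t → t < 0 → ∀ x,
      v t x = UnboundedOperators.heatExtension (v s) (t - s) x - oseenDuhamel 1 s v v t x)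
    (hdiv : ∀ t < 0, VectorCalculus.IsDivFree (v t))
    (hpol : ∀ s < 0, ∀ y, ⟪curl (v s) y, EuclideanSpace.single 2 1⟫_ℝ = 0) {κ : ℝ}
    (hrss : ∀ r : ℝ, ∀ s < 0, ∀ y, Real.exp r • v (Real.exp r ^ 2 * s) (Real.exp r • rotZ (κ * r) y) =
      rotZ (κ * r) (v s y)) :
    ∀ t < 0, ∀ x, v t x = 0 := by
  have hbdd := bdd_of_hasTypeITimeDecay hrate
  have hneg1 : (-1 : ℝ) < 0 := by norm_num
  obtain ⟨P, hP2, hpe⟩ := profileEq_of_rss hrate hcont hmild hdiv hrss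
  -- data of the slice `U = v(−1)`
  have hU3 : ContDiff ℝ 3 (v (-1)) := (analyticOnNhd_slice hcont hbdd hmild hneg1).contDiff
  have hpol1 : ∀ y, curl (v (-1)) y 2 = 0 := fun y => by
    have h1 := hpol (-1) hneg1 y
    rwa [EuclideanSpace.inner_single_right, one_mul, conj_trivial] at h1
  have hUbdd : ∀ y, ‖v (-1) y‖ ≤ C := fun y => by
    have h := hrate (-1) hneg1 y
    rwa [neg_neg, Real.sqrt_one, div_one] at h
  obtain ⟨C₁, hC₁⟩ := exists_fderiv_rate_of_class hrate hcont hmild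
  have hDU : ∀ y, ‖fderiv ℝ (v (-1)) y‖ ≤ C₁ := fun y => by
    have h := hC₁ (-1) hneg1 y
    rwa [neg_neg, div_one] at h
  obtain ⟨K, hK⟩ := exists_laplacian_bound hrate hcont hmild hdiv
  -- polynomial growth of the pressure
  have hM : 0 ≤ C := (norm_nonneg _).trans (hUbdd 0)
  have hC₁0 : 0 ≤ C₁ := (norm_nonneg _).trans (hDU 0)
  have hK0 : 0 ≤ K := (norm_nonneg _).trans (hK 0)
  have hgrad := norm_fderiv_pressure_le hpe hUbdd hDU hK
  have hA : 0 ≤ |(1 : ℝ)| * K + |(1 / 2 : ℝ)| * C + |κ / 2| * C + C₁ * C := by positivity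
  have hB : 0 ≤ |(1 / 2 : ℝ)| * C₁ + |κ / 2| * C₁ := by positivity
  have hPpoly := abs_le_sq_of_norm_fderiv_le_affine (hP2.differentiable (by norm_num)) hA hB hgrad
  -- the rotated Leray Liouville theorem, ALL rates: the slice is constant
  have hconst : ∀ x y, v (-1) x = v (-1) y :=
    rotatedLeray_const_of_poloidal_allRates hSDL one_pos (by norm_num) hU3 hP2 hpe (hdiv (-1) hneg1) hpol1 hUbdd hPpoly
  -- a constant slice is translation-invariant: the planar Liouville stratum ends the proof
  have hne : (EuclideanSpace.single 0 1 : EuclideanSpace ℝ (Fin 3)) ≠ 0 := fun h0 => by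
    simpa using congrArg (fun w : EuclideanSpace ℝ (Fin 3) => w 0) h0
  exact eq_zero_of_translate_eq_slice hrate hcont hmild hdiv hneg1 hne fun y l => hconst _ _

/-- **The vertical-axis RSS stratum is empty for every rate** (modulo `SkewDriftLiouville`): such a profile is not
backward-singular — `…SpiralSelfSimilar.nonflatLiouville_of_spiralSelfSimilar_vertical` with `hκ` deleted. -/
theorem nonflatLiouville_of_spiralSelfSimilar_vertical_allRates (hSDL : SkewDriftLiouville)
    (hrate : HasTypeITimeDecay C v)
    (hcont : ContinuousOn (uncurry v) (Iio (0 : ℝ) ×ˢ univ))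
    (hmild : ∀ s t : ℝ, s < t → t < 0 → ∀ x,
      v t x = UnboundedOperators.heatExtension (v s) (t - s) x - oseenDuhamel 1 s v v t x)
    (hdiv : ∀ t < 0, VectorCalculus.IsDivFree (v t))
    (hpol : ∀ s < 0, ∀ y, ⟪curl (v s) y, EuclideanSpace.single 2 1⟫_ℝ = 0) {κ : ℝ}
    (hrss : ∀ r : ℝ, ∀ s < 0, ∀ y, Real.exp r • v (Real.exp r ^ 2 * s) (Real.exp r • rotZ (κ * r) y) =
      rotZ (κ * r) (v s y)) :
    ¬ IsBackwardSingularPoint v 0 :=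
  Summit.NavierStokesRegularity.NavierStokesRegularity.Theorems.PoloidalWindowDoorPoloidalWindowRigidityFlat.not_backwardSingular_of_zero
    (eq_zero_of_spiralSelfSimilar_vertical_allRates hSDL hrate hcont hmild hdiv hpol hrss)

/-! ### S4 — the line's concluding statements (sorry-free since v1.1) -/

/-- LINE 17, CONCLUSION (all rates): the tree theorem `eq_zero_of_spiralSelfSimilar_vertical` without `|κ| < 1`,
(sorry-free since v1.1; the former stub name is a proved alias). -/
theorem spiralRates_eq_zero (hrate : HasTypeITimeDecay C v)
    (hcont : ContinuousOn (uncurry v) (Iio (0 : ℝ) ×ˢ univ))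
    (hmild : ∀ s t : ℝ, s < t → t < 0 → ∀ x,
      v t x = UnboundedOperators.heatExtension (v s) (t - s) x - oseenDuhamel 1 s v v t x)
    (hdiv : ∀ t < 0, VectorCalculus.IsDivFree (v t))
    (hpol : ∀ s < 0, ∀ y, ⟪curl (v s) y, EuclideanSpace.single 2 1⟫_ℝ = 0) {κ : ℝ}
    (hrss : ∀ r : ℝ, ∀ s < 0, ∀ y, Real.exp r • v (Real.exp r ^ 2 * s) (Real.exp r • rotZ (κ * r) y) =
      rotZ (κ * r) (v s y)) :
    ∀ t < 0, ∀ x, v t x = 0 :=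
  eq_zero_of_spiralSelfSimilar_vertical_allRates stub_skewDriftLiouville hrate hcont hmild hdiv hpol hrss

/-- LINE 17, CONCLUSION in the crux's shape: a vertical-axis RSS profile of the class (any rate), poloidal along the
axis, is not a backward singular point — the `¬ IsBackwardSingularPoint v 0` conjunct of
`Theses.PoloidalWindowDoor.PoloidalWindowRigidity` on this stratum. -/
theorem spiralRates_not_backwardSingular (hrate : HasTypeITimeDecay C v)
    (hcont : ContinuousOn (uncurry v) (Iio (0 : ℝ) ×ˢ univ))
    (hmild : ∀ s t : ℝ, s < t → t < 0 → ∀ x,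
      v t x = UnboundedOperators.heatExtension (v s) (t - s) x - oseenDuhamel 1 s v v t x)
    (hdiv : ∀ t < 0, VectorCalculus.IsDivFree (v t))
    (hpol : ∀ s < 0, ∀ y, ⟪curl (v s) y, EuclideanSpace.single 2 1⟫_ℝ = 0) {κ : ℝ}
    (hrss : ∀ r : ℝ, ∀ s < 0, ∀ y, Real.exp r • v (Real.exp r ^ 2 * s) (Real.exp r • rotZ (κ * r) y) =
      rotZ (κ * r) (v s y)) :
    ¬ IsBackwardSingularPoint v 0 :=
  nonflatLiouville_of_spiralSelfSimilar_vertical_allRates stub_skewDriftLiouville hrate hcont hmild hdiv hpol hrss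

end Summit.NavierStokesRegularity.NavierStokesRegularity.Cruxes.PoloidalWindowRigidity.SpiralRates

end
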